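import Literature.MathematicalPhysics.QuantumFieldTheory.Balaban1983to89.B6Prop25Eq112TwoScaleV1
import Literature.MathematicalPhysics.QuantumFieldTheory.Balaban1983to89.B6Block113GEV1
import Literature.MathematicalPhysics.QuantumFieldTheory.Balaban1983to89.B6Block113CompositesV1
import Literature.MathematicalPhysics.QuantumFieldTheory.Balaban1983to89.B6Prop25HolderRateFreeV1

/-!
# `Balaban1983to89.B6Prop25Eq113TwoScaleV1` — T. Bałaban, *Propagators and renormalization transformations for lattice gauge theories. II*,
# Commun. Math. Phys. **96** (1984) 223–250 [Balaban1984PropagatorsII], PROPOSITION 2.5 p. 246, THE MEMBER (1.113)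
# `‖ζ∇G∇*J‖_α ≤ O(1)e^{−δ₂|y−y′|}(‖ζ‖_α + |ζ|)(‖J‖_{α+ε} + |J|)` FOR THE GENUINE TWO-SCALE `G = Δ_a⁻¹` OF (2.90), `Λ′ ⊂ T^{(j+1)}` ARBITRARY, for
# `tsV1` at the paper's scaling — file M6 of the (1.112)/(1.113) members (p38 gen 22), the assembly

statement-level skeleton of published theorems with citation tags; proofs where landed; nothing here is a claim about the Yang–Mills mass gap

PDF held: `paper:balaban1984-cmp96-propagators-rt-ii` (journal page = PDF page + 222), p. 246 [PDF 24]; `paper:balaban1984-cmp95-propagators-rt-i` ([4],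
journal page = PDF page + 16), pp. 35–36 [PDF 19–20].  PRINT.  p. 246 (Proposition 2.5, verbatim): *"The operator G_□ defined by (2.90) on the torus
T_□ (or on the whole lattice ξZ^d) has the representation (2.129) and satisfies all the inequalities (1.110)–(1.114) of the Proposition 1.2 with a
positive constant δ₂ instead of δ₀. This constant depends on d and L only."*  [4] (1.113) p. 36 (verbatim, as quoted in the tree's `B5.Prop12Printed`):
*"‖ζ∇G∇*J‖_α ≤ O(1)e^{−δ₀|y−y′|}(‖ζ‖_α + |ζ|)(‖J‖_{α+ε} + |J|) (1.113) for 0 ≤ α < 1, ε > 0, α + ε < 1, ζ ∈ C₀^∞(Δ̃(y)), supp J ⊂ Δ̃(y′), with the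
constant O(1) depending on d, α and ε (O(1) → ∞ if α → 1 or ε → 0)"*, (1.109) p. 35: *"‖A‖_α = max_μ sup_{x,x′:|x−x′|≤1} |x−x′|^{−α}|A_μ(x) − A_μ(x′)|"*.

CITATION HEADER (lean-in-tree rule) — WHAT IS REPRODUCED.  Phase-2 file of the `lit-balaban` typed skeleton (HOME `run/shared/lean/pub/lit-balaban/`),
seat **p38 gen 22** (B6 fold owner r03, referee ref-4; p22 g15 hand-off 2026-08-22T10:32Z), FILE M6 of the (1.112)/(1.113) members of p22's Prop. 2.5
two-level decay programme (files M1a `…B6Block112DictionaryV1`, M1b `…B6Block112GEV1`, M2 `…B6Block112CompositesV1`, M3 `…B6Prop25Eq112TwoScaleV1`,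
M4 `…B6Block113GEV1`, M5 `…B6Block113CompositesV1`); SKELETON rows **B6.Prop2.5** / **B6.Eq2.129–2.131** and [4] **B5.Prop1.2** (cells only; decls of
record untouched).  WHAT THIS FILE DOES.  With `F = ∇_μG∇_λ*J` and the cut-off `ζ`, the (1.109) quotient of `ζF` at a fine pair `b₁ = ⟨x, ν⟩`,
`b₂ = ⟨x′, ν⟩` is controlled by the product rule `|ζ(x)F(b₁) − ζ(x′)F(b₂)| ≤ |ζ(x) − ζ(x′)|·|F(b₁)| + |ζ(x′)|·|F(b₁) − F(b₂)|` (gen 21 file H1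
`abs_cutoff_pairDiff_le`): the SUP part is the member (1.112) of file M3 (`prop25_ineq112_upto`, at the input exponent `α + ε`), the PAIR part is the
seven-summand identity of file M3 (`DGDadj_apply_eq_at`, (2.129) differentiated on both sides) at `b₁` and at `b₂`: six summands have uniform PAIR
(Hölder-in-the-output) block bounds — `∇_μK₁∇_λ*`, `(∇_μH_j)Q_jG^{(n^{d+1})}∇_λ*`, `(∇_μH_j)C̃(∇_λH_j)*` (file M5), `(∇_μM)K₂∇_λ*`, `(∇_μK₂*)M∇_λ*`,
`(∇_μK₂*)MK₂∇_λ*` (first factors gen 21 file H4a `holderBound_DGt_scaling`, `holderBound_DHjCtHj_scaling`, `holderBound_DK2adj_scaling`, tails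
p22's files 5/6/9/13/14 `blockBound_K2Dadj_scaling`, `blockBound_GtDadj_scaling`, `blockBound_HjCtDHjadj_scaling`, `blockBound_Gt_scaling`,
`blockBound_HjCtHj_scaling`, composed by `holderBound_comp`/`blockBound_comp`) and are evaluated on a source supported over the unit sites within
`r` of `y′` by file H1's `pairDiff_le_of_support`; the summand `∇_μG^{(n^{d+1})}∇_λ*J` is [4] (1.113) FOR `G_k` BY NAME in the pair form of file M4
(`pair113_DGEDadj_scaling`: the only term carrying the Hölder norm `‖J‖_{α+ε}`).  **`prop25_ineq113`**: there is `δ₂ > 0` depending on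
`d, L, a₀, a₁` only and for every `0 ≤ α`, `0 < ε`, `α + ε < 1` a `C_{αε} ≥ 0` such that for every volume, `j + 1 ≤ m + K`, `Λ′`, weights
`a₀n^{d+1} ≤ w ≤ a₁n^{d+1}`, directions `λ, μ`, radius `r ≥ 0`, every fine bond field `J` supported on the fine bonds over the unit sites within `r` of
`y′` with `|J| ≤ X` and `(α+ε)`-Hölder quotients `≤ X_θ` on same-direction pairs at `|b₋ − b₋′|_∞ ≤ n` (`n = L^j`), every cut-off `ζ` on the fine
sites supported over the unit sites within `r` of `y` with `|ζ| ≤ Z₀`, and every pair of fine bonds `b₁ = ⟨x, ν⟩`, `b₂ = ⟨x′, ν⟩` with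
`|x − x′|_∞ ≤ n` and `|ζ(x) − ζ(x′)| ≤ Z_h·t^α`, `t = |x − x′|_∞/n`:
`|ζ(x)(∇_μG∇_λ*J)(b₁) − ζ(x′)(∇_μG∇_λ*J)(b₂)| ≤ C_{αε}·e^{(1+2δ₂)(r+4)}·e^{−δ₂(1−α)|y − y′|_T}·(Z_h + Z₀)·(X_θ + X)·t^α`.  IMPORTS BY NAME,
restating nothing.  THEOREMS ONLY (no `def`, no `def … : Prop`); standard axioms.  HONEST SCOPE / DIVERGENCES. (1) One component: `∇_μ` on the
left, one `∇_λ*` on the right; the printed `‖·‖_α` (max over `μ`, sup over pairs at `|x − x′| ≤ 1` unit, sum over `λ`) is recovered pair by pair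
(r03's census slot `h2TS`). (2) `ζ ∈ C₀^∞(Δ̃(y))`, `supp J ⊂ Δ̃(y′)` are replaced by supports over the unit sites within `r` of `y`, `y′` (p22's
radius-`r` packaging; growth `e^{(1+2δ₂)(r+4)}`). (3) THE DECAY RATE `δ₂(1−α)` DEPENDS ON `α` — b05's HONEST LIMIT (i) propagated through gen 21 file
H3a (`holderBound_DHj`, rate `κ_H(1−α)/(1+α)`); the print claims `δ₂ = δ₂(d, L)`; r03's `B6HjOneLevelBridgeV1` (α-free `∇H_j` pair rate) is the
upgrade path (GAPS G-B6-p38-01). (4) `‖J‖_{α+ε}` enters as the bound `X_θ` on the Hölder quotients at pairs `|b₋ − b₋′|_∞ ≤ n`, `‖ζ‖_α + |ζ|` as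
`Z_h + Z₀` (as (1.109)). (5) No new definition, no new hypothesis.  v1.1: **`prop25_ineq113_rateFree`** — the same member with the decay
`e^{−δ₂|y − y′|_T}`, `δ₂ = δ₂(d, L, a₀, a₁)` INDEPENDENT OF `α` (the printed quantifier shape), through r03's `…B6HjOneLevelBridgeV1.holderBound_DHj_rateFree`
(file M5 v1.1 and r03's `…B6Prop25HolderRateFreeV1`); divergence (3) is thereby lifted for the `_rateFree` twin.  v1.2 (p38 gen 23, PROOF-ONLY, statements byte-identical): `prop25_ineq113_rateFree` is
proved first with every operator term elaborated once (the block/pair-bound theorems instantiated with `_` for the operator, the pair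
inequality by `congrArg₂` on `DGDadj_apply_eq_at`, nonnegativity of the constants by explicit terms instead of `positivity`/`set` in the large
context), at the DEFAULT heartbeat budget (measured 141 439 heartbeats on the farm; v1.1: `maxHeartbeats 3200000` twice), and `prop25_ineq113` is
its corollary (`e^{−δ₂D} ≤ e^{−δ₂(1−α)D}`; 24 115 heartbeats).  NOT summit progress.  Unit
`lit-balaban-p38` (gen 22; v1.2 gen 23), 2026-08-22.
-/

noncomputable section

open scoped InnerProductSpace BigOperators
open Finset

namespace Literature.MathematicalPhysics.QuantumFieldTheory.Balaban1983to89.B6Prop25Eq113TwoScaleV1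

open LatticeFieldCalculus B5SectBStatements B5Eq117TorusCarriers B6SectADomainsV1 B6SectAOperatorsV1 B6SectAVectorModelV1 B6SectCOperators
  B6SectCTwoScaleV1 B6SectCTwoScaleV1Lattice B5Eq118OneStroke
open BalabanImbrieJaffe1984to88.BIJ85AxialPropagator411 (BondSpace)
open B4Sect5Torus (IsPseudoDist SumBound)
open B4TorusKernel.MultiPeriod (torusSupNorm torusSupNorm_nonneg)
open B4Sect5Proof (latticeConst latticeConst_nonneg)
open B6LowerBound2153Torus (rep)
open B6BlockDecayCalculus (blockBound_comp blockBound_add blockBound_mono torusDist_isPseudoDist torusDist_sumBound)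
open B6BlockDecayHjCovV1 (blockBound_HjCtHj_scaling)
open B6BlockDecayGtV1 (blockBound_Gt_scaling)
open B6BlockDecayGDivFactorsV1 (blockBound_K2Dadj_scaling blockBound_HjCtDHjadj_scaling)
open B6Prop25GDivDecayTwoScaleV1 (blockBound_GtDadj_scaling)
open B6BlockHolderCalculus (holderBound_comp holderBound_add holderBound_mono pairDiff_le_of_support abs_cutoff_pairDiff_le self_le_rpow_of_le_one')
open B6BlockHolderCompositesV1 (holderBound_DK2adj_scaling holderBound_DHjCtHj_scaling holderBound_DGt_scaling)
open B6BlockDecayHprimeCovV1 (supDist_cast_eq_torusSupNorm)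
open BalabanImbrieJaffe1984to88.BIJ85Ineq722Torus (supDist_blk_le_one)
open B6Prop25Eq112TwoScaleV1 (DGDadj_apply_eq_at prop25_ineq112_upto)
open B6Block113GEV1 (pair113_DGEDadj_scaling)
open B6Block113CompositesV1 (holderBound_DK1Dadj_scaling holderBound_DHjQGEDadj_scaling holderBound_DHjCtDHjadj_scaling
  holderBound_DHjQGEDadj_rateFree holderBound_DHjCtDHjadj_rateFree)
open B6Prop25HolderRateFreeV1 (holderBound_DGt_rateFree holderBound_DHjCtHj_rateFree)

variable {d L m K : ℕ} {hd : 1 ≤ d + 1} {hL : Odd L ∧ 1 < L} {j : ℕ}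

/-! ## §1  Bookkeeping lemmas (constants, growth, the seven summands) -/

/-- decay re-anchoring: `e^{−δρ(y₀, y′)} ≤ e^{δr}e^{−δρ(y, y′)}` when `ρ(y₀, y) ≤ r` (`δ ≥ 0`). [cite: Balaban1984PropagatorsI, Prop. 1.2 (1.113) p.36 (constants bookkeeping, ours)] -/
private theorem exp_decay_shift {ρ₀ ρ ρ₁ r δ : ℝ} (hδ : 0 ≤ δ) (htri : ρ ≤ ρ₁ + ρ₀) (hρ₁ : ρ₁ ≤ r) :
    Real.exp (-(δ * ρ₀)) ≤ Real.exp (δ * r) * Real.exp (-(δ * ρ)) := by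
  rw [← Real.exp_add]
  exact Real.exp_le_exp.mpr (by nlinarith)

/-- `|t₁ + t₂ − t₃ + t₄ − t₅ − t₆ + t₇| ≤ B₁ + … + B₇` from `|tᵢ| ≤ Bᵢ`. [cite: Balaban1984PropagatorsII, Prop. 2.5 p.246 (bookkeeping of the seven summands, ours)] -/
private theorem abs_seven_le {t₁ t₂ t₃ t₄ t₅ t₆ t₇ B₁ B₂ B₃ B₄ B₅ B₆ B₇ : ℝ} (h₁ : |t₁| ≤ B₁) (h₂ : |t₂| ≤ B₂) (h₃ : |t₃| ≤ B₃)
    (h₄ : |t₄| ≤ B₄) (h₅ : |t₅| ≤ B₅) (h₆ : |t₆| ≤ B₆) (h₇ : |t₇| ≤ B₇) :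
    |t₁ + t₂ - t₃ + t₄ - t₅ - t₆ + t₇| ≤ B₁ + B₂ + B₃ + B₄ + B₅ + B₆ + B₇ := by
  have := abs_add_le (t₁ + t₂ - t₃ + t₄ - t₅ - t₆) t₇
  have := abs_sub (t₁ + t₂ - t₃ + t₄ - t₅) t₆
  have := abs_sub (t₁ + t₂ - t₃ + t₄) t₅
  have := abs_add_le (t₁ + t₂ - t₃) t₄
  have := abs_sub (t₁ + t₂) t₃
  have := abs_add_le t₁ t₂
  linarith

/-- the difference of two seven-summand values, summand by summand. [cite: Balaban1984PropagatorsII, Prop. 2.5 p.246 (bookkeeping, ours)] -/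
private theorem abs_seven_sub_le {t₁ t₂ t₃ t₄ t₅ t₆ t₇ s₁ s₂ s₃ s₄ s₅ s₆ s₇ k₁ k₂ k₃ k₄ k₅ k₆ k₇ Φ : ℝ} (h₁ : |t₁ - s₁| ≤ k₁ * Φ) (h₂ : |t₂ - s₂| ≤ k₂ * Φ)
    (h₃ : |t₃ - s₃| ≤ k₃ * Φ) (h₄ : |t₄ - s₄| ≤ k₄ * Φ) (h₅ : |t₅ - s₅| ≤ k₅ * Φ) (h₆ : |t₆ - s₆| ≤ k₆ * Φ) (h₇ : |t₇ - s₇| ≤ k₇ * Φ) :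
    |t₁ + t₂ - t₃ + t₄ - t₅ - t₆ + t₇ - (s₁ + s₂ - s₃ + s₄ - s₅ - s₆ + s₇)| ≤ (k₁ + k₂ + k₃ + k₄ + k₅ + k₆ + k₇) * Φ := by
  have e : t₁ + t₂ - t₃ + t₄ - t₅ - t₆ + t₇ - (s₁ + s₂ - s₃ + s₄ - s₅ - s₆ + s₇) =
      (t₁ - s₁) + (t₂ - s₂) - (t₃ - s₃) + (t₄ - s₄) - (t₅ - s₅) - (t₆ - s₆) + (t₇ - s₇) := by ring
  rw [e]
  refine (abs_seven_le h₁ h₂ h₃ h₄ h₅ h₆ h₇).trans (le_of_eq ?_)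
  ring

/-- growth bookkeeping (pair parts): `e^{(1+2δ′)(r+3)} ≤ e^{(1+2δ)(r+4)}` for `0 ≤ δ′ ≤ δ`, `r ≥ 0`. [cite: Balaban1984PropagatorsI, (1.113) p.36 (constants bookkeeping, ours)] -/
private theorem growth_pair_le {δ' δ r : ℝ} (h0 : 0 ≤ δ') (h1 : δ' ≤ δ) (hr : 0 ≤ r) :
    Real.exp ((1 + 2 * δ') * (r + 3)) ≤ Real.exp ((1 + 2 * δ) * (r + 4)) :=
  Real.exp_le_exp.mpr (by nlinarith)

/-- growth bookkeeping (the `G^{(n^{d+1})}` part): `e^{(1+δ′)(r+3)}e^{δ′(r+1)} ≤ e^{(1+2δ)(r+4)}`. [cite: Balaban1984PropagatorsI, (1.113) p.36 (constants bookkeeping, ours)] -/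
private theorem growth_two_le {δ' δ r : ℝ} (h0 : 0 ≤ δ') (h1 : δ' ≤ δ) (hr : 0 ≤ r) :
    Real.exp ((1 + δ') * (r + 3)) * Real.exp (δ' * (r + 1)) ≤ Real.exp ((1 + 2 * δ) * (r + 4)) := by
  rw [← Real.exp_add]
  exact Real.exp_le_exp.mpr (by nlinarith)

/-- growth bookkeeping (the sup part at radius `r + 1`): `e^{(1+2δ′)(r+1+3)} ≤ e^{(1+2δ)(r+4)}`. [cite: Balaban1984PropagatorsI, (1.113) p.36 (constants bookkeeping, ours)] -/
private theorem growth_sup_le {δ' δ r : ℝ} (h1 : δ' ≤ δ) (hr : 0 ≤ r) :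
    Real.exp ((1 + 2 * δ') * (r + 1 + 3)) ≤ Real.exp ((1 + 2 * δ) * (r + 4)) :=
  Real.exp_le_exp.mpr (by nlinarith)

/-- a pair part in the common shape: `|A| ≤ c·u·(K·G′)·D·X ≤ cK·(G·D·X′·w)` when `u ≤ w`, `G′ ≤ G`, `X ≤ X′`. [cite: Balaban1984PropagatorsI, (1.113) p.36 (constants bookkeeping, ours)] -/
private theorem piece_le {A c u w K G' G D X X' : ℝ} (hA : |A| ≤ c * u * (K * G') * D * X) (hc : 0 ≤ c) (hK : 0 ≤ K)
    (hu0 : 0 ≤ u) (huw : u ≤ w) (hG'0 : 0 ≤ G') (hGG : G' ≤ G) (hD : 0 ≤ D) (hX0 : 0 ≤ X) (hXX : X ≤ X') :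
    |A| ≤ c * K * (G * D * X' * w) := by
  refine hA.trans ?_
  have h1 : u * G' * X ≤ w * G * X' :=
    mul_le_mul (mul_le_mul huw hGG hG'0 (hu0.trans huw)) hXX hX0 (mul_nonneg (hu0.trans huw) (hG'0.trans hGG))
  calc c * u * (K * G') * D * X = (c * K * D) * (u * G' * X) := by ring
    _ ≤ (c * K * D) * (w * G * X') := mul_le_mul_of_nonneg_left h1 (mul_nonneg (mul_nonneg hc hK) hD)
    _ = c * K * (G * D * X' * w) := by ring

/-- the `G^{(n^{d+1})}` part in the common shape (re-anchored decay, absorbed growth). [cite: Balaban1984PropagatorsI, (1.113) p.36 (constants bookkeeping, ours)] -/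
private theorem piece_two_le {A C G₁ E₁ D₁ G D X' w : ℝ} (hA : |A| ≤ C * G₁ * D₁ * X' * w) (hC : 0 ≤ C) (hG₁ : 0 ≤ G₁) (hD1 : D₁ ≤ E₁ * D)
    (hG : G₁ * E₁ ≤ G) (hD : 0 ≤ D) (hX' : 0 ≤ X') (hw : 0 ≤ w) :
    |A| ≤ C * (G * D * X' * w) := by
  refine hA.trans ?_
  have h1 : G₁ * D₁ ≤ G * D := by
    calc G₁ * D₁ ≤ G₁ * (E₁ * D) := mul_le_mul_of_nonneg_left hD1 hG₁
      _ = (G₁ * E₁) * D := by ring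
      _ ≤ G * D := mul_le_mul_of_nonneg_right hG hD
  calc C * G₁ * D₁ * X' * w = C * (G₁ * D₁) * (X' * w) := by ring
    _ ≤ C * (G * D) * (X' * w) := mul_le_mul_of_nonneg_right (mul_le_mul_of_nonneg_left h1 hC) (mul_nonneg hX' hw)
    _ = C * (G * D * X' * w) := by ring

/-- the sup part in the common shape. [cite: Balaban1984PropagatorsI, (1.112) p.36 (constants bookkeeping, ours)] -/
private theorem sup_piece_le {A C G₁ G D X' : ℝ} (hA : |A| ≤ C * G₁ * D * X') (hC : 0 ≤ C) (hGG : G₁ ≤ G) (hD : 0 ≤ D) (hX' : 0 ≤ X') :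
    |A| ≤ C * (G * D * X') := by
  refine hA.trans ?_
  calc C * G₁ * D * X' = C * (D * X') * G₁ := by ring
    _ ≤ C * (D * X') * G := mul_le_mul_of_nonneg_left hGG (mul_nonneg hC (mul_nonneg hD hX'))
    _ = C * (G * D * X') := by ring

/-- the cut-off product rule combined: `Z_h·w·(S₀Φ) + Z₀·(H₀Φw) ≤ (S₀ + H₀)Φ(Z_h + Z₀)w`. [cite: Balaban1984PropagatorsI, (1.113) p.36 («(‖ζ‖_α + |ζ|)»; bookkeeping ours)] -/
private theorem cutoff_combine {Zh Z0 w S0 H0 Φ₀ : ℝ} (hZh : 0 ≤ Zh) (hZ0 : 0 ≤ Z0) (hw : 0 ≤ w) (hS0 : 0 ≤ S0) (hH0 : 0 ≤ H0) (hΦ : 0 ≤ Φ₀) :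
    Zh * w * (S0 * Φ₀) + Z0 * (H0 * (Φ₀ * w)) ≤ (S0 + H0) * Φ₀ * (Zh + Z0) * w := by
  have e : (S0 + H0) * Φ₀ * (Zh + Z0) * w - (Zh * w * (S0 * Φ₀) + Z0 * (H0 * (Φ₀ * w))) = (S0 * Z0 + H0 * Zh) * (Φ₀ * w) := by ring
  have h0 : 0 ≤ (S0 * Z0 + H0 * Zh) * (Φ₀ * w) := by positivity
  linarith

/-! ## §2  The member (1.113) with a decay rate independent of `α` (v1.1; proved first since v1.2) -/

set_option maxRecDepth 8192 in
open Classical in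
/-- **PROPOSITION 2.5, THE MEMBER (1.113) FOR THE GENUINE TWO-SCALE `G` OF (2.90), WITH A DECAY RATE INDEPENDENT OF `α`** (v1.1, the printed
quantifier shape: ONE `δ₂(d, L, a₀, a₁) > 0` before `∀ α, ε`, the constant `C_{αε}` after): as `prop25_ineq113` below with `e^{−δ₂|y − y′|_T}` for
`e^{−δ₂(1−α)|y − y′|_T}` (since v1.2 this theorem is proved FIRST and `prop25_ineq113` is its corollary) — the same proof with the `α`-free-rate pair bounds of the `H_j`-led summands: file M5 v1.1
(`holderBound_DHjQGEDadj_rateFree`, `holderBound_DHjCtDHjadj_rateFree`) and r03's `…B6Prop25HolderRateFreeV1.holderBound_DGt_rateFree`,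
`holderBound_DHjCtHj_rateFree` (all through r03's `…B6HjOneLevelBridgeV1.holderBound_DHj_rateFree`, [BIJ85] (7.2.2) via the kernel bridge (2.130);
GAPS G-B6-p38-01 upgrade path (a)). [cite: Balaban1984PropagatorsII, Prop. 2.5 p.246 («This constant depends on d and L only»); Balaban1984PropagatorsI, Prop. 1.2 (1.113) p.36, (1.109) p.35] -/
theorem prop25_ineq113_rateFree (d L : ℕ) (hd : 1 ≤ d + 1) (hL : Odd L ∧ 1 < L) {a₀ a₁ : ℝ} (ha₀ : 0 < a₀) (ha₁ : a₀ ≤ a₁) :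
    ∃ δ : ℝ, 0 < δ ∧ ∀ α ε : ℝ, 0 ≤ α → 0 < ε → α + ε < 1 → ∃ C : ℝ, 0 ≤ C ∧ ∀ (m K : ℕ) (j : ℕ) (hc : ((L : ℝ) ^ j) ≠ 0)
      (_hj : j + 1 ≤ (⟨d + 1, L, m, K, hd, hL⟩ : Params).m + (⟨d + 1, L, m, K, hd, hL⟩ : Params).K)
      (Λ' : Finset (Site (⟨d + 1, L, m, K, hd, hL⟩ : Params) (j + 1))) (w : CIdx j Λ' → ℝ)
      (_hw0 : ∀ i, a₀ * ((L : ℝ) ^ j) ^ (d + 1) ≤ w i) (_hw1 : ∀ i, w i ≤ a₁ * ((L : ℝ) ^ j) ^ (d + 1)) (lam mu : Fin (d + 1))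
      (r : ℝ) (_hr : 0 ≤ r) (J : BondSpace (⟨d + 1, L, m, K, hd, hL⟩ : Params)) (X Xθ : ℝ) (_hX : 0 ≤ X) (_hXθ : 0 ≤ Xθ) (y y' : Site (⟨d + 1, L, m, K, hd, hL⟩ : Params) j)
      (_hsupp : ∀ b : PBond (⟨d + 1, L, m, K, hd, hL⟩ : Params) 0, J b ≠ 0 → torusSupNorm (Mk (⟨d + 1, L, m, K, hd, hL⟩ : Params) j) (rep (Mk (⟨d + 1, L, m, K, hd, hL⟩ : Params) j) (iterBlockOf j b.src) - rep (Mk (⟨d + 1, L, m, K, hd, hL⟩ : Params) j) y') ≤ r)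
      (_hJ : ∀ b : PBond (⟨d + 1, L, m, K, hd, hL⟩ : Params) 0, |J b| ≤ X)
      (_hH : ∀ b b' : PBond (⟨d + 1, L, m, K, hd, hL⟩ : Params) 0, b.dir = b'.dir → supDist b.src b'.src ≤ L ^ j →
        |J b - J b'| ≤ Xθ * (((supDist b.src b'.src : ℕ) : ℝ) / (L : ℝ) ^ j) ^ (α + ε))
      (ζ : Site (⟨d + 1, L, m, K, hd, hL⟩ : Params) 0 → ℝ) (Zh Z0 : ℝ) (_hZh : 0 ≤ Zh) (_hZ0 : 0 ≤ Z0)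
      (_hζs : ∀ x : Site (⟨d + 1, L, m, K, hd, hL⟩ : Params) 0, ζ x ≠ 0 → torusSupNorm (Mk (⟨d + 1, L, m, K, hd, hL⟩ : Params) j) (rep (Mk (⟨d + 1, L, m, K, hd, hL⟩ : Params) j) (iterBlockOf j x) - rep (Mk (⟨d + 1, L, m, K, hd, hL⟩ : Params) j) y) ≤ r)
      (_hζ0 : ∀ x : Site (⟨d + 1, L, m, K, hd, hL⟩ : Params) 0, |ζ x| ≤ Z0)
      (b₁ b₂ : PBond (⟨d + 1, L, m, K, hd, hL⟩ : Params) 0) (_hdir : b₁.dir = b₂.dir) (_hle : supDist b₁.src b₂.src ≤ L ^ j)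
      (_hζh : |ζ b₁.src - ζ b₂.src| ≤ Zh * (((supDist b₁.src b₂.src : ℕ) : ℝ) / (L : ℝ) ^ j) ^ α),
      |ζ b₁.src * ((((L : ℝ) ^ j) • (onE (LinearMap.funLeft ℝ ℝ (fun b : PBond (⟨d + 1, L, m, K, hd, hL⟩ : Params) 0 => (⟨b.src.shift mu, b.dir⟩ : PBond (⟨d + 1, L, m, K, hd, hL⟩ : Params) 0))) - LinearMap.id) : BondSpace (⟨d + 1, L, m, K, hd, hL⟩ : Params) →ₗ[ℝ] BondSpace (⟨d + 1, L, m, K, hd, hL⟩ : Params))) ((tsV1 hc Λ' w).G (((((L : ℝ) ^ j) • (onE (LinearMap.funLeft ℝ ℝ (fun b : PBond (⟨d + 1, L, m, K, hd, hL⟩ : Params) 0 => (⟨b.src.unshift lam, b.dir⟩ : PBond (⟨d + 1, L, m, K, hd, hL⟩ : Params) 0))) - LinearMap.id) : BondSpace (⟨d + 1, L, m, K, hd, hL⟩ : Params) →ₗ[ℝ] BondSpace (⟨d + 1, L, m, K, hd, hL⟩ : Params))) J)) b₁ -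
        ζ b₂.src * ((((L : ℝ) ^ j) • (onE (LinearMap.funLeft ℝ ℝ (fun b : PBond (⟨d + 1, L, m, K, hd, hL⟩ : Params) 0 => (⟨b.src.shift mu, b.dir⟩ : PBond (⟨d + 1, L, m, K, hd, hL⟩ : Params) 0))) - LinearMap.id) : BondSpace (⟨d + 1, L, m, K, hd, hL⟩ : Params) →ₗ[ℝ] BondSpace (⟨d + 1, L, m, K, hd, hL⟩ : Params))) ((tsV1 hc Λ' w).G (((((L : ℝ) ^ j) • (onE (LinearMap.funLeft ℝ ℝ (fun b : PBond (⟨d + 1, L, m, K, hd, hL⟩ : Params) 0 => (⟨b.src.unshift lam, b.dir⟩ : PBond (⟨d + 1, L, m, K, hd, hL⟩ : Params) 0))) - LinearMap.id) : BondSpace (⟨d + 1, L, m, K, hd, hL⟩ : Params) →ₗ[ℝ] BondSpace (⟨d + 1, L, m, K, hd, hL⟩ : Params))) J)) b₂| ≤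
        C * Real.exp ((1 + 2 * δ) * (r + 4)) * Real.exp (-(δ * torusSupNorm (Mk (⟨d + 1, L, m, K, hd, hL⟩ : Params) j) (rep (Mk (⟨d + 1, L, m, K, hd, hL⟩ : Params) j) y - rep (Mk (⟨d + 1, L, m, K, hd, hL⟩ : Params) j) y'))) * (Zh + Z0) * (Xθ + X) * (((supDist b₁.src b₂.src : ℕ) : ℝ) / (L : ℝ) ^ j) ^ α := by
  obtain ⟨δ₁, hδ₁, C₁, hC₁, hP1⟩ := holderBound_DK1Dadj_scaling d L hd hL
  obtain ⟨δ₂, hδ₂, HT2⟩ := pair113_DGEDadj_scaling d L hd hL one_pos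
  obtain ⟨δ₃, hδ₃, HP3⟩ := holderBound_DHjQGEDadj_rateFree d L hd hL
  obtain ⟨δ₄, hδ₄, HP4⟩ := holderBound_DHjCtDHjadj_rateFree d L hd hL ha₀ ha₁
  obtain ⟨δ₅, hδ₅, HP5⟩ := holderBound_DGt_rateFree d L hd hL
  obtain ⟨δ₆, hδ₆, HP6⟩ := holderBound_DHjCtHj_rateFree d L hd hL ha₀ ha₁
  obtain ⟨δ₇, hδ₇, C₇, hC₇, hK2D⟩ := blockBound_K2Dadj_scaling d L hd hL
  obtain ⟨δ₈, hδ₈, C₈, hC₈, hP8⟩ := holderBound_DK2adj_scaling d L hd hL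
  obtain ⟨δ₉, hδ₉, C₉, hC₉, hGtD⟩ := blockBound_GtDadj_scaling d L hd hL
  obtain ⟨δ₁₀, hδ₁₀, C₁₀, hC₁₀, hHCHD⟩ := blockBound_HjCtDHjadj_scaling d L hd hL ha₀ ha₁
  obtain ⟨δ₁₁, hδ₁₁, C₁₁, hC₁₁, hGt⟩ := blockBound_Gt_scaling d L hd hL
  obtain ⟨δ₁₂, hδ₁₂, C₁₂, hC₁₂, hHCH⟩ := blockBound_HjCtHj_scaling d L hd hL ha₀ ha₁
  obtain ⟨δ₁₃, hδ₁₃, H13⟩ := prop25_ineq112_upto d L hd hL ha₀ ha₁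
  -- the common `α`-free rate
  set δ₀ : ℝ := min (min (min (min (min δ₁ δ₂) (min δ₃ δ₄)) (min (min δ₅ δ₆) (min δ₇ δ₈))) (min (min δ₉ δ₁₀) (min δ₁₁ δ₁₂))) δ₁₃ with hδ₀
  have hδ₀0 : 0 < δ₀ :=
    lt_min (lt_min (lt_min (lt_min (lt_min hδ₁ hδ₂) (lt_min hδ₃ hδ₄)) (lt_min (lt_min hδ₅ hδ₆) (lt_min hδ₇ hδ₈))) (lt_min (lt_min hδ₉ hδ₁₀) (lt_min hδ₁₁ hδ₁₂))) hδ₁₃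
  have hA : δ₀ ≤ min (min (min (min δ₁ δ₂) (min δ₃ δ₄)) (min (min δ₅ δ₆) (min δ₇ δ₈))) (min (min δ₉ δ₁₀) (min δ₁₁ δ₁₂)) := min_le_left _ _
  have h01 : δ₀ ≤ δ₁ := hA.trans ((min_le_left _ _).trans ((min_le_left _ _).trans ((min_le_left _ _).trans (min_le_left _ _))))
  have h02 : δ₀ ≤ δ₂ := hA.trans ((min_le_left _ _).trans ((min_le_left _ _).trans ((min_le_left _ _).trans (min_le_right _ _))))
  have h03 : δ₀ ≤ δ₃ := hA.trans ((min_le_left _ _).trans ((min_le_left _ _).trans ((min_le_right _ _).trans (min_le_left _ _))))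
  have h04 : δ₀ ≤ δ₄ := hA.trans ((min_le_left _ _).trans ((min_le_left _ _).trans ((min_le_right _ _).trans (min_le_right _ _))))
  have h05 : δ₀ ≤ δ₅ := hA.trans ((min_le_left _ _).trans ((min_le_right _ _).trans ((min_le_left _ _).trans (min_le_left _ _))))
  have h06 : δ₀ ≤ δ₆ := hA.trans ((min_le_left _ _).trans ((min_le_right _ _).trans ((min_le_left _ _).trans (min_le_right _ _))))
  have h07 : δ₀ ≤ δ₇ := hA.trans ((min_le_left _ _).trans ((min_le_right _ _).trans ((min_le_right _ _).trans (min_le_left _ _))))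
  have h08 : δ₀ ≤ δ₈ := hA.trans ((min_le_left _ _).trans ((min_le_right _ _).trans ((min_le_right _ _).trans (min_le_right _ _))))
  have h09 : δ₀ ≤ δ₉ := hA.trans ((min_le_right _ _).trans ((min_le_left _ _).trans (min_le_left _ _)))
  have h010 : δ₀ ≤ δ₁₀ := hA.trans ((min_le_right _ _).trans ((min_le_left _ _).trans (min_le_right _ _)))
  have h011 : δ₀ ≤ δ₁₁ := hA.trans ((min_le_right _ _).trans ((min_le_right _ _).trans (min_le_left _ _)))
  have h012 : δ₀ ≤ δ₁₂ := hA.trans ((min_le_right _ _).trans ((min_le_right _ _).trans (min_le_right _ _)))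
  have h013 : δ₀ ≤ δ₁₃ := min_le_right _ _
  set Ka : ℝ := latticeConst (d + 1) (δ₀ - δ₀ / 2) with hKa
  have hKa0 : 0 ≤ Ka := latticeConst_nonneg _ (by linarith)
  have hK10 : 0 ≤ latticeConst (d + 1) 1 := latticeConst_nonneg _ zero_le_one
  have hL0 : 0 < L := by have := hL.2; omega
  have hLp : (0 : ℝ) < L := by exact_mod_cast hL0
  have hq0 : 0 < δ₀ / 4 := div_pos hδ₀0 four_pos
  refine ⟨δ₀ / 4, hq0, fun α ε hα0 hε0 hαε => ?_⟩
  have hα1 : α < 1 := by linarith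
  have hαε0 : 0 < α + ε := by linarith
  -- the common rate `δ⋆ = δ₀/4` of all eight parts (independent of `α`)
  have hs0 : 0 < δ₀ / 4 := hq0
  have hs4 : δ₀ / 4 ≤ δ₀ / 4 := le_rfl
  have hs0' : δ₀ / 4 ≤ δ₀ := by linarith
  have hs2 : δ₀ / 4 ≤ δ₀ / 2 := by linarith
  have hsa : δ₀ / 4 < δ₀ := by linarith
  have hsa' : 0 ≤ δ₀ - δ₀ / 4 := by linarith
  have hh0 : (0 : ℝ) ≤ δ₀ / 2 := by linarith
  have hh1 : δ₀ / 2 ≤ δ₀ := by linarith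
  have hh2 : δ₀ / 2 < δ₀ := by linarith
  set Kα : ℝ := latticeConst (d + 1) (δ₀ - δ₀ / 4) with hKα
  have hKα0 : 0 ≤ Kα := latticeConst_nonneg _ hsa'
  obtain ⟨C₂, hC₂, hT2⟩ := HT2 (δ₀ / 4) hs0 (hs0'.trans h02) α ε hα0 hε0 hαε
  obtain ⟨C₃, hC₃, hP3⟩ := HP3 α hα0 hα1
  obtain ⟨C₄, hC₄, hP4⟩ := HP4 α hα0 hα1
  obtain ⟨C₅, hC₅, hP5⟩ := HP5 α hα0 hα1
  obtain ⟨C₆, hC₆, hP6⟩ := HP6 α hα0 hα1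
  obtain ⟨C₁₃, hC₁₃, hS13⟩ := H13 (δ₀ / 4) hs0 (hs0'.trans h013) (α + ε) hαε0 hαε
  -- the pair constants of the seven summands and the sup constant; nonnegativity by explicit terms (no `positivity` search, no `set`)
  have hδh : (0 : ℝ) ≤ δ₀ - δ₀ / 2 := by linarith
  have hk5c : 0 ≤ (C₅ + C₆) * C₇ * Kα := mul_nonneg (mul_nonneg (add_nonneg hC₅ hC₆) hC₇) hKα0
  have hk6c : 0 ≤ C₈ * (C₉ + C₁₀) * Kα := mul_nonneg (mul_nonneg hC₈ (add_nonneg hC₉ hC₁₀)) hKα0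
  have hk7g : 0 ≤ (C₁₁ + C₁₂) * C₇ * latticeConst (d + 1) (δ₀ - δ₀ / 2) := mul_nonneg (mul_nonneg (add_nonneg hC₁₁ hC₁₂) hC₇) (latticeConst_nonneg _ hδh)
  have hk7c : 0 ≤ C₈ * ((C₁₁ + C₁₂) * C₇ * Ka) * Kα := mul_nonneg (mul_nonneg hC₈ (mul_nonneg (mul_nonneg (add_nonneg hC₁₁ hC₁₂) hC₇) hKa0)) hKα0
  have hKH0 : 0 ≤ C₁ * latticeConst (d + 1) 1 + C₂ + C₃ * latticeConst (d + 1) 1 + C₄ * latticeConst (d + 1) 1 + (C₅ + C₆) * C₇ * Kα * latticeConst (d + 1) 1 + C₈ * (C₉ + C₁₀) * Kα * latticeConst (d + 1) 1 + C₈ * ((C₁₁ + C₁₂) * C₇ * Ka) * Kα * latticeConst (d + 1) 1 :=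
    add_nonneg (add_nonneg (add_nonneg (add_nonneg (add_nonneg (add_nonneg (mul_nonneg hC₁ hK10) hC₂) (mul_nonneg hC₃ hK10)) (mul_nonneg hC₄ hK10))
      (mul_nonneg hk5c hK10)) (mul_nonneg hk6c hK10)) (mul_nonneg hk7c hK10)
  have hC0 : 0 ≤ C₁₃ + (C₁ * latticeConst (d + 1) 1 + C₂ + C₃ * latticeConst (d + 1) 1 + C₄ * latticeConst (d + 1) 1 + (C₅ + C₆) * C₇ * Kα * latticeConst (d + 1) 1 + C₈ * (C₉ + C₁₀) * Kα * latticeConst (d + 1) 1 + C₈ * ((C₁₁ + C₁₂) * C₇ * Ka) * Kα * latticeConst (d + 1) 1) := add_nonneg hC₁₃ hKH0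
  refine ⟨C₁₃ + (C₁ * latticeConst (d + 1) 1 + C₂ + C₃ * latticeConst (d + 1) 1 + C₄ * latticeConst (d + 1) 1 + (C₅ + C₆) * C₇ * Kα * latticeConst (d + 1) 1 + C₈ * (C₉ + C₁₀) * Kα * latticeConst (d + 1) 1 + C₈ * ((C₁₁ + C₁₂) * C₇ * Ka) * Kα * latticeConst (d + 1) 1), hC0, ?_⟩
  intro m K j hc hj Λ' w hw0 hw1 lam mu r hr J X Xθ hX hXθ y y' hsupp hJ hH ζ Zh Z0 hZh hZ0 hζs hζ0 b₁ b₂ hdir hle hζh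
  have hj' : j ≤ m + K := Nat.le_of_succ_le hj
  have hLj : (0 : ℝ) < (L : ℝ) ^ j := pow_pos hLp j
  have hw : ∀ i, 0 < w i := fun i => lt_of_lt_of_le (mul_pos ha₀ (pow_pos hLj (d + 1))) (hw0 i)
  have hw' : (0 : ℝ) < 1 * ((L : ℝ) ^ j) ^ (d + 1) := by rw [one_mul]; exact pow_pos hLj (d + 1)
  have hρ : IsPseudoDist (fun t t' : Site (⟨d + 1, L, m, K, hd, hL⟩ : Params) j => torusSupNorm (Mk (⟨d + 1, L, m, K, hd, hL⟩ : Params) j) (rep (Mk (⟨d + 1, L, m, K, hd, hL⟩ : Params) j) t - rep (Mk (⟨d + 1, L, m, K, hd, hL⟩ : Params) j) t')) := torusDist_isPseudoDist (Mk (⟨d + 1, L, m, K, hd, hL⟩ : Params) j)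
  have hK : SumBound (fun t t' : Site (⟨d + 1, L, m, K, hd, hL⟩ : Params) j => torusSupNorm (Mk (⟨d + 1, L, m, K, hd, hL⟩ : Params) j) (rep (Mk (⟨d + 1, L, m, K, hd, hL⟩ : Params) j) t - rep (Mk (⟨d + 1, L, m, K, hd, hL⟩ : Params) j) t')) (fun a => latticeConst (d + 1) a) := torusDist_sumBound (Mk (⟨d + 1, L, m, K, hd, hL⟩ : Params) j)
  have ht0 : 0 ≤ (((supDist b₁.src b₂.src : ℕ) : ℝ) / (L : ℝ) ^ j) := div_nonneg (Nat.cast_nonneg _) hLj.le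
  have ht1 : (((supDist b₁.src b₂.src : ℕ) : ℝ) / (L : ℝ) ^ j) ≤ 1 := by rw [div_le_one hLj]; exact_mod_cast hle
  have htα0 : 0 ≤ (((supDist b₁.src b₂.src : ℕ) : ℝ) / (L : ℝ) ^ j) ^ α := Real.rpow_nonneg ht0 α
  have htα : (((supDist b₁.src b₂.src : ℕ) : ℝ) / (L : ℝ) ^ j) ≤ (((supDist b₁.src b₂.src : ℕ) : ℝ) / (L : ℝ) ^ j) ^ α := self_le_rpow_of_le_one' ht0 ht1 hα1.le
  have hXX : 0 ≤ Xθ + X := add_nonneg hXθ hX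
  have hXle : X ≤ Xθ + X := le_add_of_nonneg_left hXθ
  have hG0 : 0 ≤ Real.exp ((1 + 2 * (δ₀ / 4)) * (r + 4)) := (Real.exp_pos _).le
  have hD0 : 0 ≤ Real.exp (-(δ₀ / 4 * torusSupNorm (Mk (⟨d + 1, L, m, K, hd, hL⟩ : Params) j) (rep (Mk (⟨d + 1, L, m, K, hd, hL⟩ : Params) j) y - rep (Mk (⟨d + 1, L, m, K, hd, hL⟩ : Params) j) y'))) := (Real.exp_pos _).le
  -- the trivial case: both values of the cut-off vanish
  by_cases hz : ζ b₁.src = 0 ∧ ζ b₂.src = 0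
  · rw [hz.1, hz.2, zero_mul, zero_mul, sub_zero, abs_zero]
    exact mul_nonneg (mul_nonneg (mul_nonneg (mul_nonneg (mul_nonneg hC0 (Real.exp_pos _).le) (Real.exp_pos _).le) (add_nonneg hZh hZ0)) hXX) htα0
  -- otherwise the anchor `y(x)` is within `r + 1` of `y` (`|y(x) − y(x′)|_T ≤ 1`)
  have hz1 : torusSupNorm (Mk (⟨d + 1, L, m, K, hd, hL⟩ : Params) j) (rep (Mk (⟨d + 1, L, m, K, hd, hL⟩ : Params) j) (iterBlockOf j b₁.src) - rep (Mk (⟨d + 1, L, m, K, hd, hL⟩ : Params) j) y) ≤ r + 1 := by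
    rw [not_and_or] at hz
    rcases hz with h1 | h2
    · exact (hζs _ h1).trans (le_add_of_nonneg_right zero_le_one)
    · have h12 : torusSupNorm (Mk (⟨d + 1, L, m, K, hd, hL⟩ : Params) j) (rep (Mk (⟨d + 1, L, m, K, hd, hL⟩ : Params) j) (iterBlockOf j b₁.src) - rep (Mk (⟨d + 1, L, m, K, hd, hL⟩ : Params) j) (iterBlockOf j b₂.src)) ≤ 1 := by
        rw [← supDist_cast_eq_torusSupNorm]
        exact_mod_cast supDist_blk_le_one hj' b₁.src b₂.src hle
      calc torusSupNorm (Mk (⟨d + 1, L, m, K, hd, hL⟩ : Params) j) (rep (Mk (⟨d + 1, L, m, K, hd, hL⟩ : Params) j) (iterBlockOf j b₁.src) - rep (Mk (⟨d + 1, L, m, K, hd, hL⟩ : Params) j) y)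
          ≤ torusSupNorm (Mk (⟨d + 1, L, m, K, hd, hL⟩ : Params) j) (rep (Mk (⟨d + 1, L, m, K, hd, hL⟩ : Params) j) (iterBlockOf j b₁.src) - rep (Mk (⟨d + 1, L, m, K, hd, hL⟩ : Params) j) (iterBlockOf j b₂.src)) + torusSupNorm (Mk (⟨d + 1, L, m, K, hd, hL⟩ : Params) j) (rep (Mk (⟨d + 1, L, m, K, hd, hL⟩ : Params) j) (iterBlockOf j b₂.src) - rep (Mk (⟨d + 1, L, m, K, hd, hL⟩ : Params) j) y) := hρ.triangle _ _ _
        _ ≤ 1 + r := add_le_add h12 (hζs _ h2)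
        _ = r + 1 := add_comm _ _
  have hz3 : torusSupNorm (Mk (⟨d + 1, L, m, K, hd, hL⟩ : Params) j) (rep (Mk (⟨d + 1, L, m, K, hd, hL⟩ : Params) j) (iterBlockOf j b₁.src) - rep (Mk (⟨d + 1, L, m, K, hd, hL⟩ : Params) j) y) ≤ r + 3 := hz1.trans (by linarith)
  have hsupp3 : ∀ b : PBond (⟨d + 1, L, m, K, hd, hL⟩ : Params) 0, J b ≠ 0 → torusSupNorm (Mk (⟨d + 1, L, m, K, hd, hL⟩ : Params) j) (rep (Mk (⟨d + 1, L, m, K, hd, hL⟩ : Params) j) (iterBlockOf j b.src) - rep (Mk (⟨d + 1, L, m, K, hd, hL⟩ : Params) j) y') ≤ r + 3 := fun b hb => (hsupp b hb).trans (le_add_of_nonneg_right zero_le_three)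
  have hsupp1 : ∀ b : PBond (⟨d + 1, L, m, K, hd, hL⟩ : Params) 0, J b ≠ 0 → torusSupNorm (Mk (⟨d + 1, L, m, K, hd, hL⟩ : Params) j) (rep (Mk (⟨d + 1, L, m, K, hd, hL⟩ : Params) j) (iterBlockOf j b.src) - rep (Mk (⟨d + 1, L, m, K, hd, hL⟩ : Params) j) y') ≤ r + 1 := fun b hb => (hsupp b hb).trans (le_add_of_nonneg_right zero_le_one)
  -- (a) the block bounds of the tails (p22 files 5/9/13/14), at the rate `δ₀`, `δ₀/2`
  have bK2D := blockBound_mono hρ _ (fun b₀ : PBond (⟨d + 1, L, m, K, hd, hL⟩ : Params) 0 => iterBlockOf j b₀.src) (fun b₀ : PBond (⟨d + 1, L, m, K, hd, hL⟩ : Params) 0 => iterBlockOf j b₀.src) hC₇ le_rfl h07 (hK2D m K j hc hj Λ' w hw lam)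
  have bMD := blockBound_add (ρ := (fun t t' : Site (⟨d + 1, L, m, K, hd, hL⟩ : Params) j => torusSupNorm (Mk (⟨d + 1, L, m, K, hd, hL⟩ : Params) j) (rep (Mk (⟨d + 1, L, m, K, hd, hL⟩ : Params) j) t - rep (Mk (⟨d + 1, L, m, K, hd, hL⟩ : Params) j) t'))) _ _ (fun b₀ : PBond (⟨d + 1, L, m, K, hd, hL⟩ : Params) 0 => iterBlockOf j b₀.src) (fun b₀ : PBond (⟨d + 1, L, m, K, hd, hL⟩ : Params) 0 => iterBlockOf j b₀.src)
    (blockBound_mono hρ _ (fun b₀ : PBond (⟨d + 1, L, m, K, hd, hL⟩ : Params) 0 => iterBlockOf j b₀.src) (fun b₀ : PBond (⟨d + 1, L, m, K, hd, hL⟩ : Params) 0 => iterBlockOf j b₀.src) hC₉ le_rfl h09 (hGtD m K j hc hj Λ' w hw lam))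
    (blockBound_mono hρ _ (fun b₀ : PBond (⟨d + 1, L, m, K, hd, hL⟩ : Params) 0 => iterBlockOf j b₀.src) (fun b₀ : PBond (⟨d + 1, L, m, K, hd, hL⟩ : Params) 0 => iterBlockOf j b₀.src) hC₁₀ le_rfl h010 (hHCHD m K j hc hj Λ' w hw0 hw1 lam))
  have bM := blockBound_add (ρ := (fun t t' : Site (⟨d + 1, L, m, K, hd, hL⟩ : Params) j => torusSupNorm (Mk (⟨d + 1, L, m, K, hd, hL⟩ : Params) j) (rep (Mk (⟨d + 1, L, m, K, hd, hL⟩ : Params) j) t - rep (Mk (⟨d + 1, L, m, K, hd, hL⟩ : Params) j) t'))) _ _ (fun b₀ : PBond (⟨d + 1, L, m, K, hd, hL⟩ : Params) 0 => iterBlockOf j b₀.src) (fun b₀ : PBond (⟨d + 1, L, m, K, hd, hL⟩ : Params) 0 => iterBlockOf j b₀.src)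
    (blockBound_mono hρ _ (fun b₀ : PBond (⟨d + 1, L, m, K, hd, hL⟩ : Params) 0 => iterBlockOf j b₀.src) (fun b₀ : PBond (⟨d + 1, L, m, K, hd, hL⟩ : Params) 0 => iterBlockOf j b₀.src) hC₁₁ le_rfl h011 (hGt m K j hc hj Λ' w hw))
    (blockBound_mono hρ _ (fun b₀ : PBond (⟨d + 1, L, m, K, hd, hL⟩ : Params) 0 => iterBlockOf j b₀.src) (fun b₀ : PBond (⟨d + 1, L, m, K, hd, hL⟩ : Params) 0 => iterBlockOf j b₀.src) hC₁₂ le_rfl h012 (hHCH m K j hc hj Λ' w hw0 hw1))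
  have bMK2D := blockBound_comp hρ hK _ _ (fun b₀ : PBond (⟨d + 1, L, m, K, hd, hL⟩ : Params) 0 => iterBlockOf j b₀.src) (fun b₀ : PBond (⟨d + 1, L, m, K, hd, hL⟩ : Params) 0 => iterBlockOf j b₀.src) (fun b₀ : PBond (⟨d + 1, L, m, K, hd, hL⟩ : Params) 0 => iterBlockOf j b₀.src)
    (Cf := C₁₁ + C₁₂) (Cg := C₇) (add_nonneg hC₁₁ hC₁₂) hC₇ hh0 hh1 hh2 bM bK2D
  -- (b) the pair bounds of the first factors (gen 21 file H4a), weakened to the common rates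
  have pf5 := holderBound_add (ρ := (fun t t' : Site (⟨d + 1, L, m, K, hd, hL⟩ : Params) j => torusSupNorm (Mk (⟨d + 1, L, m, K, hd, hL⟩ : Params) j) (rep (Mk (⟨d + 1, L, m, K, hd, hL⟩ : Params) j) t - rep (Mk (⟨d + 1, L, m, K, hd, hL⟩ : Params) j) t'))) _ _ (fun b₀ : PBond (⟨d + 1, L, m, K, hd, hL⟩ : Params) 0 => iterBlockOf j b₀.src) b₁ b₂ (iterBlockOf j b₁.src)
    (holderBound_mono hρ _ (fun b₀ : PBond (⟨d + 1, L, m, K, hd, hL⟩ : Params) 0 => iterBlockOf j b₀.src) b₁ b₂ (iterBlockOf j b₁.src) (C' := C₅ * (((supDist b₁.src b₂.src : ℕ) : ℝ) / (L : ℝ) ^ j) ^ α) (mul_nonneg hC₅ htα0) le_rfl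
      h05 (hP5 m K j hc hj Λ' w hw mu b₁ b₂ hdir hle))
    (holderBound_mono hρ _ (fun b₀ : PBond (⟨d + 1, L, m, K, hd, hL⟩ : Params) 0 => iterBlockOf j b₀.src) b₁ b₂ (iterBlockOf j b₁.src) (C' := C₆ * (((supDist b₁.src b₂.src : ℕ) : ℝ) / (L : ℝ) ^ j) ^ α) (mul_nonneg hC₆ htα0) le_rfl
      h06 (hP6 m K j hc hj Λ' w hw0 hw1 mu b₁ b₂ hdir hle))
  have pf6 := holderBound_mono hρ _ (fun b₀ : PBond (⟨d + 1, L, m, K, hd, hL⟩ : Params) 0 => iterBlockOf j b₀.src) b₁ b₂ (iterBlockOf j b₁.src) (C' := C₈ * (((supDist b₁.src b₂.src : ℕ) : ℝ) / (L : ℝ) ^ j)) (mul_nonneg hC₈ ht0) le_rfl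
      h08 (hP8 m K j hc hj Λ' w hw mu b₁ b₂ hdir hle)
  -- (c) the pair bounds of the seven summands at `(b₁, b₂)`, anchored at `y(x)`, all at the rate `δ⋆`
  have p1 := holderBound_mono hρ _ (fun b₀ : PBond (⟨d + 1, L, m, K, hd, hL⟩ : Params) 0 => iterBlockOf j b₀.src) b₁ b₂ (iterBlockOf j b₁.src) (C' := C₁ * (((supDist b₁.src b₂.src : ℕ) : ℝ) / (L : ℝ) ^ j)) (mul_nonneg hC₁ ht0) le_rfl (hs0'.trans h01)
    (hP1 m K j hc hj Λ' w hw lam mu b₁ b₂ hdir hle)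
  have p3 := holderBound_mono hρ _ (fun b₀ : PBond (⟨d + 1, L, m, K, hd, hL⟩ : Params) 0 => iterBlockOf j b₀.src) b₁ b₂ (iterBlockOf j b₁.src) (C' := C₃ * (((supDist b₁.src b₂.src : ℕ) : ℝ) / (L : ℝ) ^ j) ^ α) (mul_nonneg hC₃ htα0) le_rfl
    (hs0'.trans h03) (hP3 m K j hc hj Λ' w hw hw' lam mu b₁ b₂ hdir hle)
  have p4 := holderBound_mono hρ _ (fun b₀ : PBond (⟨d + 1, L, m, K, hd, hL⟩ : Params) 0 => iterBlockOf j b₀.src) b₁ b₂ (iterBlockOf j b₁.src) (C' := C₄ * (((supDist b₁.src b₂.src : ℕ) : ℝ) / (L : ℝ) ^ j) ^ α) (mul_nonneg hC₄ htα0) le_rfl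
    (hs0'.trans h04) (hP4 m K j hc hj Λ' w hw0 hw1 lam mu b₁ b₂ hdir hle)
  have p5' := holderBound_comp hρ hK _ _ (fun b₀ : PBond (⟨d + 1, L, m, K, hd, hL⟩ : Params) 0 => iterBlockOf j b₀.src) (fun b₀ : PBond (⟨d + 1, L, m, K, hd, hL⟩ : Params) 0 => iterBlockOf j b₀.src) b₁ b₂ (iterBlockOf j b₁.src)
    (Cf := C₅ * (((supDist b₁.src b₂.src : ℕ) : ℝ) / (L : ℝ) ^ j) ^ α + C₆ * (((supDist b₁.src b₂.src : ℕ) : ℝ) / (L : ℝ) ^ j) ^ α) (Cg := C₇) (add_nonneg (mul_nonneg hC₅ htα0) (mul_nonneg hC₆ htα0)) hC₇ hs0.le hs0' hsa pf5 bK2D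
  have p5 := holderBound_mono hρ _ (fun b₀ : PBond (⟨d + 1, L, m, K, hd, hL⟩ : Params) 0 => iterBlockOf j b₀.src) b₁ b₂ (iterBlockOf j b₁.src)
    (C := (C₅ * (((supDist b₁.src b₂.src : ℕ) : ℝ) / (L : ℝ) ^ j) ^ α + C₆ * (((supDist b₁.src b₂.src : ℕ) : ℝ) / (L : ℝ) ^ j) ^ α) * C₇ * latticeConst (d + 1) (δ₀ - δ₀ / 4)) (C' := (C₅ + C₆) * C₇ * Kα * (((supDist b₁.src b₂.src : ℕ) : ℝ) / (L : ℝ) ^ j) ^ α)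
    (mul_nonneg hk5c htα0) (le_of_eq (by rw [hKα]; ring)) le_rfl p5'
  have p6' := holderBound_comp hρ hK _ _ (fun b₀ : PBond (⟨d + 1, L, m, K, hd, hL⟩ : Params) 0 => iterBlockOf j b₀.src) (fun b₀ : PBond (⟨d + 1, L, m, K, hd, hL⟩ : Params) 0 => iterBlockOf j b₀.src) b₁ b₂ (iterBlockOf j b₁.src)
    (Cf := C₈ * (((supDist b₁.src b₂.src : ℕ) : ℝ) / (L : ℝ) ^ j)) (Cg := C₉ + C₁₀) (mul_nonneg hC₈ ht0) (add_nonneg hC₉ hC₁₀) hs0.le hs0' hsa pf6 bMD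
  have p6 := holderBound_mono hρ _ (fun b₀ : PBond (⟨d + 1, L, m, K, hd, hL⟩ : Params) 0 => iterBlockOf j b₀.src) b₁ b₂ (iterBlockOf j b₁.src)
    (C := C₈ * (((supDist b₁.src b₂.src : ℕ) : ℝ) / (L : ℝ) ^ j) * (C₉ + C₁₀) * latticeConst (d + 1) (δ₀ - δ₀ / 4)) (C' := C₈ * (C₉ + C₁₀) * Kα * (((supDist b₁.src b₂.src : ℕ) : ℝ) / (L : ℝ) ^ j))
    (mul_nonneg hk6c ht0) (le_of_eq (by rw [hKα]; ring)) le_rfl p6'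
  have p7' := holderBound_comp hρ hK _ _ (fun b₀ : PBond (⟨d + 1, L, m, K, hd, hL⟩ : Params) 0 => iterBlockOf j b₀.src) (fun b₀ : PBond (⟨d + 1, L, m, K, hd, hL⟩ : Params) 0 => iterBlockOf j b₀.src) b₁ b₂ (iterBlockOf j b₁.src)
    (Cf := C₈ * (((supDist b₁.src b₂.src : ℕ) : ℝ) / (L : ℝ) ^ j)) (Cg := (C₁₁ + C₁₂) * C₇ * latticeConst (d + 1) (δ₀ - δ₀ / 2)) (mul_nonneg hC₈ ht0) hk7g hs0.le hs2 hsa pf6 bMK2D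
  have p7 := holderBound_mono hρ _ (fun b₀ : PBond (⟨d + 1, L, m, K, hd, hL⟩ : Params) 0 => iterBlockOf j b₀.src) b₁ b₂ (iterBlockOf j b₁.src)
    (C := C₈ * (((supDist b₁.src b₂.src : ℕ) : ℝ) / (L : ℝ) ^ j) * ((C₁₁ + C₁₂) * C₇ * latticeConst (d + 1) (δ₀ - δ₀ / 2)) * latticeConst (d + 1) (δ₀ - δ₀ / 4))
    (C' := C₈ * ((C₁₁ + C₁₂) * C₇ * Ka) * Kα * (((supDist b₁.src b₂.src : ℕ) : ℝ) / (L : ℝ) ^ j))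
    (mul_nonneg hk7c ht0) (le_of_eq (by rw [hKα, hKa]; ring)) le_rfl p7'
  -- (d) the six block summands evaluated at `J` (radius `r + 3`, gen 21 file H1), then normalised
  have e1 := pairDiff_le_of_support hρ hK _ (fun b₀ : PBond (⟨d + 1, L, m, K, hd, hL⟩ : Params) 0 => iterBlockOf j b₀.src) b₁ b₂ (iterBlockOf j b₁.src) (mul_nonneg hC₁ ht0) hs0.le hX p1 J y y' hsupp3 hJ hz3
  have e3 := pairDiff_le_of_support hρ hK _ (fun b₀ : PBond (⟨d + 1, L, m, K, hd, hL⟩ : Params) 0 => iterBlockOf j b₀.src) b₁ b₂ (iterBlockOf j b₁.src) (mul_nonneg hC₃ htα0) hs0.le hX p3 J y y' hsupp3 hJ hz3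
  have e4 := pairDiff_le_of_support hρ hK _ (fun b₀ : PBond (⟨d + 1, L, m, K, hd, hL⟩ : Params) 0 => iterBlockOf j b₀.src) b₁ b₂ (iterBlockOf j b₁.src) (mul_nonneg hC₄ htα0) hs0.le hX p4 J y y' hsupp3 hJ hz3
  have e5 := pairDiff_le_of_support hρ hK _ (fun b₀ : PBond (⟨d + 1, L, m, K, hd, hL⟩ : Params) 0 => iterBlockOf j b₀.src) b₁ b₂ (iterBlockOf j b₁.src) (mul_nonneg hk5c htα0) hs0.le hX p5 J y y' hsupp3 hJ hz3
  have e6 := pairDiff_le_of_support hρ hK _ (fun b₀ : PBond (⟨d + 1, L, m, K, hd, hL⟩ : Params) 0 => iterBlockOf j b₀.src) b₁ b₂ (iterBlockOf j b₁.src) (mul_nonneg hk6c ht0) hs0.le hX p6 J y y' hsupp3 hJ hz3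
  have e7 := pairDiff_le_of_support hρ hK _ (fun b₀ : PBond (⟨d + 1, L, m, K, hd, hL⟩ : Params) 0 => iterBlockOf j b₀.src) b₁ b₂ (iterBlockOf j b₁.src) (mul_nonneg hk7c ht0) hs0.le hX p7 J y y' hsupp3 hJ hz3
  have hGp : Real.exp ((1 + 2 * (δ₀ / 4)) * (r + 3)) ≤ Real.exp ((1 + 2 * (δ₀ / 4)) * (r + 4)) := growth_pair_le hs0.le hs4 hr
  have hGp0 : 0 ≤ Real.exp ((1 + 2 * (δ₀ / 4)) * (r + 3)) := (Real.exp_pos _).le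
  have f1 := piece_le e1 hC₁ hK10 ht0 htα hGp0 hGp hD0 hX hXle
  have f3 := piece_le e3 hC₃ hK10 htα0 le_rfl hGp0 hGp hD0 hX hXle
  have f4 := piece_le e4 hC₄ hK10 htα0 le_rfl hGp0 hGp hD0 hX hXle
  have f5 := piece_le e5 hk5c hK10 htα0 le_rfl hGp0 hGp hD0 hX hXle
  have f6 := piece_le e6 hk6c hK10 ht0 htα hGp0 hGp hD0 hX hXle
  have f7 := piece_le e7 hk7c hK10 ht0 htα hGp0 hGp hD0 hX hXle
  -- (e) the (1.113) summand `∇_μG^{(n^{d+1})}∇_λ*J` (file M4), its decay re-anchored from `y(x)` to `y`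
  have e2 := hT2 m K j (Nat.le_of_succ_le hj) hc hw' lam mu J X Xθ r hX hXθ y' hsupp hJ hH b₁ b₂ hdir hle
  have hsh := exp_decay_shift (δ := δ₀ / 4) (r := r + 1) hs0.le (hρ.triangle y (iterBlockOf j b₁.src) y')
    ((le_of_eq (hρ.symm y (iterBlockOf j b₁.src))).trans hz1)
  have f2 := piece_two_le e2 hC₂ (Real.exp_pos _).le hsh (growth_two_le hs0.le hs4 hr) hD0 hXX htα0
  -- (f) the sup part: the member (1.112) at the exponent `α + ε`, radius `r + 1` (file M3)
  have eS := hS13 m K j hc hj Λ' w hw0 hw1 lam mu (r + 1) (add_nonneg hr zero_le_one) J X Xθ hX hXθ y y' hsupp1 hJ hH b₁ hz1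
  have fS := sup_piece_le eS hC₁₃ (growth_sup_le hs4 hr) hD0 hXX
  -- (g) the identity (file M3) and the seven summands
  have hHx := (congrArg₂ (fun u v : ℝ => |u - v|)
    (DGDadj_apply_eq_at (d := d) (L := L) (m := m) (K := K) (hd := hd) (hL := hL) hc hj Λ' hw hw' lam mu J b₁)
    (DGDadj_apply_eq_at (d := d) (L := L) (m := m) (K := K) (hd := hd) (hL := hL) hc hj Λ' hw hw' lam mu J b₂)).trans_le
    (abs_seven_sub_le f1 f2 f3 f4 f5 f6 f7)
  -- (h) the cut-off product rule
  refine (abs_cutoff_pairDiff_le fS hHx hζh (hζ0 b₂.src)).trans ?_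
  refine (cutoff_combine hZh hZ0 htα0 hC₁₃ hKH0 (mul_nonneg (mul_nonneg (Real.exp_pos _).le (Real.exp_pos _).le) hXX : 0 ≤ Real.exp ((1 + 2 * (δ₀ / 4)) * (r + 4)) * Real.exp (-(δ₀ / 4 * torusSupNorm (Mk (⟨d + 1, L, m, K, hd, hL⟩ : Params) j) (rep (Mk (⟨d + 1, L, m, K, hd, hL⟩ : Params) j) y - rep (Mk (⟨d + 1, L, m, K, hd, hL⟩ : Params) j) y'))) * (Xθ + X))).trans (le_of_eq ?_)
  ring

/-! ## §3  Proposition 2.5, the member (1.113), in the shape of v1.0 (rate `δ₂(1−α)`) — a corollary -/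

set_option maxRecDepth 8192 in
open Classical in
/-- **PROPOSITION 2.5, THE MEMBER (1.113) `‖ζ∇G∇*J‖_α ≤ O(1)e^{−δ₂|y−y′|}(‖ζ‖_α + |ζ|)(‖J‖_{α+ε} + |J|)` FOR THE GENUINE TWO-SCALE `G` OF (2.90)**,
`Λ′` arbitrary (at `c = L^j`, weights `a₀n^{d+1} ≤ w ≤ a₁n^{d+1}`), one component `μ` of `∇` and one component `λ` of `∇*`, one pair of the (1.109)
quotient: there is `δ₂ > 0` depending on `d, L, a₀, a₁` only and for every `0 ≤ α`, `0 < ε`, `α + ε < 1` a `C_{αε} ≥ 0` such that for every volume,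
`j + 1 ≤ m + K`, `Λ′`, weights in the window, directions `λ, μ`, radius `r ≥ 0`, every fine bond field `J` supported on the fine bonds over the unit sites
within `r` of `y′` with `|J| ≤ X` and Hölder quotients `|J(b) − J(b′)| ≤ X_θ·(|b₋ − b₋′|_∞/n)^{α+ε}` on same-direction pairs at `|b₋ − b₋′|_∞ ≤ n`, every
cut-off `ζ` on the fine sites supported over the unit sites within `r` of `y` with `|ζ| ≤ Z₀`, and every pair of fine bonds `b₁ = ⟨x, ν⟩`, `b₂ = ⟨x′, ν⟩`
with `|x − x′|_∞ ≤ n` at which `|ζ(x) − ζ(x′)| ≤ Z_h·(|x − x′|_∞/n)^α`: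
`|ζ(x)(∇_μG∇_λ*J)(b₁) − ζ(x′)(∇_μG∇_λ*J)(b₂)| ≤ C_{αε}·e^{(1+2δ₂)(r+4)}·e^{−δ₂(1−α)|y − y′|_T}·(Z_h + Z₀)·(X_θ + X)·(|x − x′|_∞/n)^α`,
`(∇_λ*J)(b) = n(J(b − e_λ) − J(b))`, `(∇_μA)(b) = n(A(b + e_μ) − A(b))`.  v1.2: a COROLLARY of `prop25_ineq113_rateFree` (same `δ₂`, same `C_{αε}`;
`e^{−δ₂|y − y′|_T} ≤ e^{−δ₂(1−α)|y − y′|_T}` for `0 ≤ α ≤ 1`) — the v1.0 proof at the rate `δ₂(1−α)` is superseded. [cite: Balaban1984PropagatorsII, Prop. 2.5 p.246; Balaban1984PropagatorsI, Prop. 1.2 (1.113) p.36, (1.109) p.35] -/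
theorem prop25_ineq113 (d L : ℕ) (hd : 1 ≤ d + 1) (hL : Odd L ∧ 1 < L) {a₀ a₁ : ℝ} (ha₀ : 0 < a₀) (ha₁ : a₀ ≤ a₁) :
    ∃ δ : ℝ, 0 < δ ∧ ∀ α ε : ℝ, 0 ≤ α → 0 < ε → α + ε < 1 → ∃ C : ℝ, 0 ≤ C ∧ ∀ (m K : ℕ) (j : ℕ) (hc : ((L : ℝ) ^ j) ≠ 0)
      (_hj : j + 1 ≤ (⟨d + 1, L, m, K, hd, hL⟩ : Params).m + (⟨d + 1, L, m, K, hd, hL⟩ : Params).K)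
      (Λ' : Finset (Site (⟨d + 1, L, m, K, hd, hL⟩ : Params) (j + 1))) (w : CIdx j Λ' → ℝ)
      (_hw0 : ∀ i, a₀ * ((L : ℝ) ^ j) ^ (d + 1) ≤ w i) (_hw1 : ∀ i, w i ≤ a₁ * ((L : ℝ) ^ j) ^ (d + 1)) (lam mu : Fin (d + 1))
      (r : ℝ) (_hr : 0 ≤ r) (J : BondSpace (⟨d + 1, L, m, K, hd, hL⟩ : Params)) (X Xθ : ℝ) (_hX : 0 ≤ X) (_hXθ : 0 ≤ Xθ) (y y' : Site (⟨d + 1, L, m, K, hd, hL⟩ : Params) j)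
      (_hsupp : ∀ b : PBond (⟨d + 1, L, m, K, hd, hL⟩ : Params) 0, J b ≠ 0 → torusSupNorm (Mk (⟨d + 1, L, m, K, hd, hL⟩ : Params) j) (rep (Mk (⟨d + 1, L, m, K, hd, hL⟩ : Params) j) (iterBlockOf j b.src) - rep (Mk (⟨d + 1, L, m, K, hd, hL⟩ : Params) j) y') ≤ r)
      (_hJ : ∀ b : PBond (⟨d + 1, L, m, K, hd, hL⟩ : Params) 0, |J b| ≤ X)
      (_hH : ∀ b b' : PBond (⟨d + 1, L, m, K, hd, hL⟩ : Params) 0, b.dir = b'.dir → supDist b.src b'.src ≤ L ^ j →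
        |J b - J b'| ≤ Xθ * (((supDist b.src b'.src : ℕ) : ℝ) / (L : ℝ) ^ j) ^ (α + ε))
      (ζ : Site (⟨d + 1, L, m, K, hd, hL⟩ : Params) 0 → ℝ) (Zh Z0 : ℝ) (_hZh : 0 ≤ Zh) (_hZ0 : 0 ≤ Z0)
      (_hζs : ∀ x : Site (⟨d + 1, L, m, K, hd, hL⟩ : Params) 0, ζ x ≠ 0 → torusSupNorm (Mk (⟨d + 1, L, m, K, hd, hL⟩ : Params) j) (rep (Mk (⟨d + 1, L, m, K, hd, hL⟩ : Params) j) (iterBlockOf j x) - rep (Mk (⟨d + 1, L, m, K, hd, hL⟩ : Params) j) y) ≤ r)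
      (_hζ0 : ∀ x : Site (⟨d + 1, L, m, K, hd, hL⟩ : Params) 0, |ζ x| ≤ Z0)
      (b₁ b₂ : PBond (⟨d + 1, L, m, K, hd, hL⟩ : Params) 0) (_hdir : b₁.dir = b₂.dir) (_hle : supDist b₁.src b₂.src ≤ L ^ j)
      (_hζh : |ζ b₁.src - ζ b₂.src| ≤ Zh * (((supDist b₁.src b₂.src : ℕ) : ℝ) / (L : ℝ) ^ j) ^ α),
      |ζ b₁.src * ((((L : ℝ) ^ j) • (onE (LinearMap.funLeft ℝ ℝ (fun b : PBond (⟨d + 1, L, m, K, hd, hL⟩ : Params) 0 => (⟨b.src.shift mu, b.dir⟩ : PBond (⟨d + 1, L, m, K, hd, hL⟩ : Params) 0))) - LinearMap.id) : BondSpace (⟨d + 1, L, m, K, hd, hL⟩ : Params) →ₗ[ℝ] BondSpace (⟨d + 1, L, m, K, hd, hL⟩ : Params))) ((tsV1 hc Λ' w).G (((((L : ℝ) ^ j) • (onE (LinearMap.funLeft ℝ ℝ (fun b : PBond (⟨d + 1, L, m, K, hd, hL⟩ : Params) 0 => (⟨b.src.unshift lam, b.dir⟩ : PBond (⟨d + 1,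 L, m, K, hd, hL⟩ : Params) 0))) - LinearMap.id) : BondSpace (⟨d + 1, L, m, K, hd, hL⟩ : Params) →ₗ[ℝ] BondSpace (⟨d + 1, L, m, K, hd, hL⟩ : Params))) J)) b₁ -
        ζ b₂.src * ((((L : ℝ) ^ j) • (onE (LinearMap.funLeft ℝ ℝ (fun b : PBond (⟨d + 1, L, m, K, hd, hL⟩ : Params) 0 => (⟨b.src.shift mu, b.dir⟩ : PBond (⟨d + 1, L, m, K, hd, hL⟩ : Params) 0))) - LinearMap.id) : BondSpace (⟨d + 1, L, m, K, hd, hL⟩ : Params) →ₗ[ℝ] BondSpace (⟨d + 1, L, m, K, hd, hL⟩ : Params))) ((tsV1 hc Λ' w).G (((((L : ℝ) ^ j) • (onE (LinearMap.funLeft ℝ ℝ (fun b : PBond (⟨d + 1, L, m, K, hd, hL⟩ : Params) 0 => (⟨b.src.unshift lam, b.dir⟩ : PBond (⟨d + 1, L, m, K, hd, hL⟩ : Params) 0))) - LinearMap.id) : BondSpace (⟨d + 1, L, m, K, hd, hL⟩ : Params) →ₗ[ℝ] BondSpace (⟨d + 1, L, m, K, hd, hL⟩ : Params))) J)) b₂|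 ≤
        C * Real.exp ((1 + 2 * δ) * (r + 4)) * Real.exp (-(δ * (1 - α) * torusSupNorm (Mk (⟨d + 1, L, m, K, hd, hL⟩ : Params) j) (rep (Mk (⟨d + 1, L, m, K, hd, hL⟩ : Params) j) y - rep (Mk (⟨d + 1, L, m, K, hd, hL⟩ : Params) j) y'))) * (Zh + Z0) * (Xθ + X) * (((supDist b₁.src b₂.src : ℕ) : ℝ) / (L : ℝ) ^ j) ^ α := by
  obtain ⟨δ, hδ, H⟩ := prop25_ineq113_rateFree d L hd hL ha₀ ha₁
  refine ⟨δ, hδ, fun α ε hα0 hε0 hαε => ?_⟩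
  obtain ⟨C, hC, HC⟩ := H α ε hα0 hε0 hαε
  refine ⟨C, hC, ?_⟩
  intro m K j hc hj Λ' w hw0 hw1 lam mu r hr J X Xθ hX hXθ y y' hsupp hJ hH ζ Zh Z0 hZh hZ0 hζs hζ0 b₁ b₂ hdir hle hζh
  refine (HC m K j hc hj Λ' w hw0 hw1 lam mu r hr J X Xθ hX hXθ y y' hsupp hJ hH ζ Zh Z0 hZh hZ0 hζs hζ0 b₁ b₂ hdir hle hζh).trans ?_
  -- `e^{−δρ} ≤ e^{−δ(1−α)ρ}` for `ρ ≥ 0`, `0 ≤ α` (real arithmetic over an opaque `ρ`)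
  have key : ∀ {ρ : ℝ}, 0 ≤ ρ → Real.exp (-(δ * ρ)) ≤ Real.exp (-(δ * (1 - α) * ρ)) := fun {ρ} hρ =>
    Real.exp_le_exp.mpr (by nlinarith [mul_nonneg (mul_nonneg hδ.le hα0) hρ])
  exact mul_le_mul_of_nonneg_right (mul_le_mul_of_nonneg_right (mul_le_mul_of_nonneg_right
    (mul_le_mul_of_nonneg_left (key ((torusDist_isPseudoDist (Mk (⟨d + 1, L, m, K, hd, hL⟩ : Params) j)).nonneg y y')) (mul_nonneg hC (Real.exp_pos _).le)) (add_nonneg hZh hZ0)) (add_nonneg hXθ hX))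
    (Real.rpow_nonneg (div_nonneg (Nat.cast_nonneg _) (pow_nonneg (Nat.cast_nonneg _) j)) α)

end Literature.MathematicalPhysics.QuantumFieldTheory.Balaban1983to89.B6Prop25Eq113TwoScaleV1

end
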